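import Literature.MathematicalPhysics.QuantumFieldTheory.BalabanImbrieJaffe1984to88.BIJ88Ineq5144EndChainNDecay

/-!
# `BalabanImbrieJaffe1984to88.BIJ88Ineq5144EndChainNWalkCount` — T. Bałaban, J. Imbrie, A. Jaffe, *Effective action and cluster properties of the
abelian Higgs model*, Commun. Math. Phys. **114** (1988) 257–315 [BalabanImbrieJaffe1988], Sect. 5.14 (5.14.4) p. 309–310 [PDF 53–54] with Sect.
5.13 p. 307 [PDF 51]: **(5.14.4), LOCATED, ON END-DECORATED CHAINS OF EVERY LENGTH WITH PRINT'S PER-CUBE COUNT — THE LINEAGE'S DECLARED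
BOOKKEEPING DIVERGENCE REMOVED** — in `BIJ88Ineq5144EndChainDecay` (v1.1 θ-accounting) and `BIJ88Ineq5144EndChainNDecay` the factor `θ^{β′}` of
the undecorated cube `□_b` adjacent to the decoration is taken from the located surplus of clause (ii) `K_Y e^{2GK₁} ≤ θ^{1+β′}/2` (resp. from
the two-cube vacuum clause `e^{2GK₁} − 1 ≤ θ^{2β′}/2`) instead of from the walk — a DECLARED BOOKKEEPING DIVERGENCE from print, which pays EVERY
undecorated cube of `X_β ∖ H_β` by the decay of the chain of covariances (p. 307: *"If the walk ω(α) wanders through more than a few cubes, we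
begin to pickup factors e^{−cr(e_k)}"*; p. 310: *"a factor of e^{−cr(e_k)|X|}"*) and each `V^{(k)}(Y)`-derivative by ONE factor
`e^β(L^kε/ε₀)^{1/4−α}` (p. 309) with no surplus; owner r16 v2.293 and referee ref-5 g70 recorded the (ii)+hvac clause pair as the record condition
of the instance.  THIS FILE shows the divergence is a choice of CLAUSE, not of MECHANISM: the same conditioning proof gives the located (5.14.4) on
end-decorated chains of every length from

  the PLAIN per-derivative clause `K_Y e^{2GK₁} ≤ θ/2` (print's factor per `V^{(k)}(Y)`-derivative, no located surplus — the head's one-cube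
  kind `hKθ`), the ONE-CUBE vacuum clause `e^{2GK₁} − 1 ≤ θ^{β′}/2` (`□_a`'s own factor; p. 307 *"|g₂(X_α) − 1| ≦ e^β(L^kε/ε₀)^{1/4−α}"* for
  `|X_α| = 1`), and the decay paying ALL `N − 1` undecorated cubes through the size-free clauses `4W³R³c₁²δ² ≤ m·θ^{2β′}` (at `N = 3` the two
  decay factors `δ·δ` pay `□_b` AND `□_n`) and `2δ² ≤ θ^{β′}` (each further cube) — `regime_chainN_all`: `2^{N−1}·W·R·(Wc₁δ^{N−2}R)²/m ≤
  θ^{β′(N−1)}` for every `N ≥ 3`.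

θ-ACCOUNTING, matched factor for factor with print: `θ^{|H|}` ← one `θ` per derivative (`K₀ = (θ/2)^{|H|}`, `2^{|H|} ≥ 2` absorbs the engine's
`2K₀`); `θ^{β′(N−1)}` ← the decay, one `e^{−cr(e_k)}`-worth per undecorated cube (`2(N−2) ≥ N−1` factors `δ`); vacuum: `θ^{β′}` ← `□_a`'s clause,
`θ^{β′(N−1)}` ← the decay.  DIVERGENCE OF METHOD unchanged (one conditioned `s_n`-derivative instead of print's iterated derivatives and walk).
The clauses of this file and of `BIJ88Ineq5144EndChainNDecay` are not comparable (weaker slot clauses, stronger regime base); both are instances.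

statement-level skeleton of published theorems with citation tags; proofs where landed; nothing here is a claim about the Yang–Mills mass gap

PDF held: `paper:balaban1988-cmp114-bij-abelian-higgs-effective-action` (journal page = PDF page + 256); p. 309 (p0053 L14–16), p. 307 (p0051), p. 310 (p0054)
as quoted here and in `BIJ88Ineq5144EndChainDecay`.

WHAT IS PROVED (unit `lit-balaban-p36`, generation 20 of the Phase-2 proof seat p36; SKELETON rows C2.Eq5.14.3-5.14.4 (flip item instances) /
C2.Eq5.14.5 (C1 xref: the record condition (b) of ref-5 g70) of `HOME/lit-balaban-r16/ROWS-C2-part2.md`, owner r16; 0 definitions, 0 `Prop`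
facts, theorems only): `regime_chainN_all`, `bookkeeping_nonempty_all`, `bookkeeping_empty_all`, **`ineq5144_locAct_endChainN_of_decay_walkCount`**,
**`ineq5144_locAct_endChainN_of_combesThomas_walkCount`**.  HONEST SCOPE: sourceless end-decorated CHAINS; the V-half of C5 at the HEAD of row
C2.Eq5.14.5 is untouched (this is an instance-level statement); χ-decorated cubes, middle decorations NOT covered.  Imports
`BIJ88Ineq5144EndChainNDecay` (p36 g20); modifies nothing.  NOT summit progress; NOT continuum; NOT Clay.  Cell `lit-balaban` Phase 2, seat p36 gen
20 (owner r16, referee ref-5).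
-/

noncomputable section

open Finset MeasureTheory Matrix Function Filter
open Literature.MathematicalPhysics.QuantumFieldTheory.Balaban1983to89
open Literature.MathematicalPhysics.QuantumFieldTheory.BalabanImbrieJaffe1984to88
open B2Eq228Conditioning (In Out resIn resOut glue blkIn blkMix condShift)
open BIJ88Sect5Statements (CutoffProfile)
open BIJ88DirichletForms305 (interpForm interpForm_posDef quadForm_interpForm_ge)
open BIJ88PolymerRep5134 (corner)
open BIJ88PolymerRep5134GaussWitness (corner_mem_cube)
open BIJ88Expansion5143Gauss (fD fD_local)
open BIJ88SlotMomentsGauss308 (uD)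
open BIJ88SlotConnectedGraph310 (uD_local)
open BIJ88Eq5145CornerModel (slotB slotY)
open BIJ88Eq5145CornerUrsell (cubeIn)
open BIJ88W6PrimeVsupp (actIn)
open BIJ88Ineq5144Located (locAct locAct_of_loc locAct_of_not_loc)
open BIJ88SecondOrder5133 (num Dfun)
open BIJ88ActInFarCube309 (abs_actIn_le_of_condMean_fluct)
open BIJ88EndChainFluct309 (exists_quadForm_le)
open BIJ88EndChainNFluct309 (fluct_le_chainN)
open BIJ88Ineq5144EndChainDecay (fD_eq_one_of_free measurable_fD_of_inr abs_fD_le_of_inr abs_fD_empty_sub_one_le)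
open BIJ88Ineq5144EndChainCT (restricted_inv_decay_pow)

namespace Literature.MathematicalPhysics.QuantumFieldTheory.BalabanImbrieJaffe1984to88.BIJ88Ineq5144EndChainNWalkCount

/-! ## §1 The size-free regime clauses paying EVERY undecorated cube, and the exponent bookkeeping -/

/-- **the two size-free clauses imply the `N`-cube regime inequality with ALL `N − 1` undecorated cubes paid, for every `N = k + 3 ≥ 3`**:
`2^{N−1}·W·R·(Wc₁δ^{N−2}R)²/m = (4W³R³c₁²δ²/m)·(2δ²)^{N−3} ≤ θ^{2β′}·θ^{β′(N−3)} = θ^{β′(N−1)}`. [cite: BalabanImbrieJaffe1988, (5.14.4) p.309–310] -/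
theorem regime_chainN_all {W R c₁ δ m θ β' : ℝ} (hW : 0 ≤ W) (hR : 0 ≤ R) (hm : 0 < m) (hθ0 : 0 < θ)
    (hδθ₂ : 4 * (W ^ 3 * R ^ 3 * c₁ ^ 2 * δ ^ 2) ≤ m * θ ^ (2 * β')) (hstep : 2 * δ ^ 2 ≤ θ ^ β') (k : ℕ) :
    (2 : ℝ) ^ (k + 2) * (W * R * ((W * (c₁ * δ ^ (k + 1) * R)) ^ 2 * m⁻¹)) ≤ θ ^ (β' * ((k : ℝ) + 2)) := by
  induction k with
  | zero =>
    have h0 : (2 : ℝ) ^ (0 + 2) * (W * R * ((W * (c₁ * δ ^ (0 + 1) * R)) ^ 2 * m⁻¹)) =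
        4 * (W ^ 3 * R ^ 3 * c₁ ^ 2 * δ ^ 2) * m⁻¹ := by ring
    rw [h0, Nat.cast_zero, zero_add, show β' * (2 : ℝ) = 2 * β' by ring, mul_inv_le_iff₀ hm]
    linarith
  | succ k ih =>
    have h1 : (2 : ℝ) ^ (k + 1 + 2) * (W * R * ((W * (c₁ * δ ^ (k + 1 + 1) * R)) ^ 2 * m⁻¹)) =
        (2 * δ ^ 2) * ((2 : ℝ) ^ (k + 2) * (W * R * ((W * (c₁ * δ ^ (k + 1) * R)) ^ 2 * m⁻¹))) := by ring
    have h0 : 0 ≤ (2 : ℝ) ^ (k + 2) * (W * R * ((W * (c₁ * δ ^ (k + 1) * R)) ^ 2 * m⁻¹)) := by positivity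
    rw [h1, Nat.cast_succ, show β' * ((k : ℝ) + 1 + 2) = β' + β' * ((k : ℝ) + 2) by ring, Real.rpow_add hθ0]
    exact mul_le_mul hstep ih h0 (Real.rpow_nonneg hθ0.le _)

/-- decorated chain of `k` cubes, every undecorated cube paid by the decay: `2^{k−1}·(2·(θ/2)^h·M) ≤ θ^{h + β′(k−1)}` when `h ≥ 1` and
`2^{k−1}M ≤ θ^{β′(k−1)}`. [cite: BalabanImbrieJaffe1988, (5.14.4) p.309] -/
theorem bookkeeping_nonempty_all {θ β' M : ℝ} (hθ0 : 0 < θ) {h k : ℕ} (hh : 1 ≤ h) (hM0 : 0 ≤ M)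
    (hreg : 2 ^ (k - 1) * M ≤ θ ^ (β' * ((k : ℝ) - 1))) :
    (2 : ℝ) ^ (k - 1) * (2 * (θ / 2) ^ h * M) ≤ θ ^ ((h : ℝ) + β' * ((k : ℝ) - 1)) := by
  have h2h : (2 : ℝ) ≤ 2 ^ h := by
    calc (2 : ℝ) = 2 ^ 1 := (pow_one _).symm
      _ ≤ 2 ^ h := pow_le_pow_right₀ (by norm_num) hh
  have hhalf : 2 * (θ / 2) ^ h ≤ θ ^ h := by
    rw [div_pow]
    have hθh : 0 ≤ θ ^ h := pow_nonneg hθ0.le _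
    have h2p : (0 : ℝ) < 2 ^ h := by positivity
    rw [mul_div_assoc', div_le_iff₀ h2p]
    nlinarith
  calc (2 : ℝ) ^ (k - 1) * (2 * (θ / 2) ^ h * M) = (2 * (θ / 2) ^ h) * (2 ^ (k - 1) * M) := by ring
    _ ≤ θ ^ h * θ ^ (β' * ((k : ℝ) - 1)) :=
        mul_le_mul hhalf hreg (mul_nonneg (pow_nonneg (by norm_num) _) hM0) (pow_nonneg hθ0.le _)
    _ = θ ^ ((h : ℝ) + β' * ((k : ℝ) - 1)) := by rw [← Real.rpow_natCast, ← Real.rpow_add hθ0]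

/-- vacuum chain of `k` cubes: `2^{k−1}·(2·(θ^{β′}/2)·M) ≤ θ^{β′k}` when `2^{k−1}M ≤ θ^{β′(k−1)}`. [cite: BalabanImbrieJaffe1988, (5.14.4) p.309] -/
theorem bookkeeping_empty_all {θ β' M : ℝ} (hθ0 : 0 < θ) {k : ℕ} (hreg : 2 ^ (k - 1) * M ≤ θ ^ (β' * ((k : ℝ) - 1))) :
    (2 : ℝ) ^ (k - 1) * (2 * (θ ^ β' / 2) * M) ≤ θ ^ ((0 : ℝ) + β' * (k : ℝ)) := by
  have h0 : 0 ≤ θ ^ β' := Real.rpow_nonneg hθ0.le _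
  calc (2 : ℝ) ^ (k - 1) * (2 * (θ ^ β' / 2) * M) = θ ^ β' * (2 ^ (k - 1) * M) := by ring
    _ ≤ θ ^ β' * θ ^ (β' * ((k : ℝ) - 1)) := mul_le_mul_of_nonneg_left hreg h0
    _ = θ ^ ((0 : ℝ) + β' * (k : ℝ)) := by rw [← Real.rpow_add hθ0]; congr 1; ring

/-! ## §2 (5.14.4), located, on end-decorated chains of every length — every undecorated cube paid by the decay -/

section Main

variable {α I : Type} [Fintype α] [DecidableEq α] [Fintype I] [DecidableEq I] (blk : α → I) (Δ : Matrix α α ℝ) (ℱ : α → ℝ)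
variable (adj : I → I → Prop) [DecidableRel adj]
variable (χ : CutoffProfile) {ι υ : Type} [DecidableEq ι] [DecidableEq υ]
variable (p ek : ℝ) (B : Finset ι) (Φ : ι → (α → ℝ) → ℝ) (c : ι → ℝ) (Ys : Finset υ) (V : υ → (α → ℝ) → ℝ)
variable (cube : ↥B ⊕ ↥Ys → I)

/-- **(5.14.4) LOCATED ON AN END-DECORATED CHAIN OF ANY LENGTH — EVERY UNDECORATED CUBE PAID BY THE DECAY** — the class of
`BIJ88Ineq5144EndChainNDecay.ineq5144_locAct_endChainN_of_decay` with the located surplus clause (ii) REPLACED by the plain per-derivative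
clause `K_Y e^{2GK₁} ≤ θ/2`, the vacuum clause by its one-cube form `e^{2GK₁} − 1 ≤ θ^{β′}/2`, and the regime base clause STRENGTHENED to
`4W³R³c₁²δ² ≤ m·θ^{2β′}` (see the module docstring). [cite: BalabanImbrieJaffe1988, (5.14.4) p.309–310; p.307 (Sect. 5.13)] -/
theorem ineq5144_locAct_endChainN_of_decay_walkCount [Fintype ι] [Fintype υ]
    (hΔ : Δ.PosDef) {m : ℝ} (hm : 0 < m) (hΔm : ∀ φ : α → ℝ, m * (φ ⬝ᵥ φ) ≤ φ ⬝ᵥ (Δ *ᵥ φ))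
    (hΦloc : ∀ b : B, ∀ φ ψ : α → ℝ, (∀ x, blk x = cube (Sum.inl b) → φ x = ψ x) → Φ b φ = Φ b ψ)
    (hVloc : ∀ Y : Ys, ∀ φ ψ : α → ℝ, (∀ x, blk x = cube (Sum.inr Y) → φ x = ψ x) → V Y φ = V Y ψ)
    (hV : ∀ Y ∈ Ys, Measurable (V Y)) {KY : υ → ℝ} (hK : ∀ Y ∈ Ys, ∀ φ, |V Y φ| ≤ KY Y)
    {K₁ : ℝ} (hK₁0 : 0 ≤ K₁) (hK₁ : ∀ Y ∈ Ys, KY Y ≤ K₁) {G : ℕ} (hG : ∀ i, (univ.filter fun τ : ↥B ⊕ ↥Ys => cube τ = i).card ≤ G)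
    {θ β' : ℝ} (hθ0 : 0 < θ) (hθ1 : θ ≤ 1) (hβ : 0 ≤ β')
    (hvac₁ : Real.exp (2 * G * K₁) - 1 ≤ θ ^ β' / 2) (hKθ : ∀ Y ∈ Ys, KY Y * Real.exp (2 * G * K₁) ≤ θ / 2)
    -- the geometry letters W (sites per cube) and R (off-diagonal row sums of `Δ`)
    {W : ℕ} (hW : ∀ i, (univ.filter fun x : α => blk x = i).card ≤ W)
    {R : ℝ} (hR0 : 0 ≤ R) (hR : ∀ x, ∑ y ∈ univ.filter (fun y => blk y ≠ blk x), |Δ x y| ≤ R)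
    -- the class: the sourceless end-decorated chain `X″ = a – b – ⋯ – n`
    (hℱ : ℱ = 0) (X'' : Finset I) {a b n : I} (haX : a ∈ X'') (hbX : b ∈ X'') (hnX : n ∈ X'') (hab : a ≠ b) (han : a ≠ n) (hbn : b ≠ n)
    (haV : ∀ b' : ↥B, cube (Sum.inl b') ≠ a) (hfree : ∀ τ : ↥B ⊕ ↥Ys, cube τ ∈ X'' → cube τ = a)
    (hnbr : ∀ l k, blk l ∈ X'' → blk l ≠ a → blk k = a → Δ l k ≠ 0 → blk l = b)
    -- the decay letter (b), the chain's depth, the two size-free regime clauses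
    (ds : α → α → ℕ) {c₁ δ : ℝ} (hc₁ : 0 ≤ c₁) (hδ0 : 0 ≤ δ) (hδ1 : δ ≤ 1)
    (hgeo : ∀ x l, (blk x = n ∨ (blk x ∈ X'' ∧ ∃ y, blk y = n ∧ Δ y x ≠ 0)) → blk l = b → (∃ k, blk k = a ∧ Δ l k ≠ 0) →
      X''.card - 2 ≤ ds x l)
    (Λc X : Finset I)
    (hdec : ∀ s : I → ℝ, (∀ l, 0 ≤ s l ∧ s l ≤ 1) → (∀ l, l ∉ X'' → s l = 0) →
      ∀ x l : In (fun x => blk x ≠ a),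
        |(blkIn (fun x => blk x ≠ a) (interpForm blk (interpForm blk Δ (corner ℝ Λc)) s))⁻¹ x l| ≤ c₁ * δ ^ ds x.1 l.1)
    (hδθ₂ : 4 * ((W : ℝ) ^ 3 * R ^ 3 * c₁ ^ 2 * δ ^ 2) ≤ m * θ ^ (2 * β')) (hstep : 2 * δ ^ 2 ≤ θ ^ β')
    {t : ℝ} (ht0 : 0 ≤ t) (ht1 : t ≤ 1) {L : Type} [DecidableEq L] (γ : L → ↥(slotB B Ys cube X) ⊕ ↥(slotY B Ys cube X)) (H : Finset L) :
    |locAct (cubeIn cube X ∘ γ) (actIn blk Δ ℱ adj χ p ek B Φ c Ys V cube Λc X t γ) H X''| ≤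
      θ ^ ((H.card : ℝ) + β' * ((X'' \ H.image (cubeIn cube X ∘ γ)).card : ℝ)) := by
  subst hℱ
  by_cases hloc : ∀ j ∈ H, (cubeIn cube X ∘ γ) j ∈ X''
  swap
  · rw [locAct_of_not_loc hloc, abs_zero]
    exact Real.rpow_nonneg hθ0.le _
  rw [locAct_of_loc hloc]
  -- the chain has at least the three cubes `a, b, n`
  have h3 : 3 ≤ X''.card := by
    have hsub : ({a, b, n} : Finset I) ⊆ X'' := by
      intro i hi
      simp only [mem_insert, mem_singleton] at hi
      rcases hi with rfl | rfl | rfl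
      exacts [haX, hbX, hnX]
    have hc : ({a, b, n} : Finset I).card = 3 := by
      rw [card_insert_of_notMem (by simp only [mem_insert, mem_singleton, not_or]; exact ⟨hab, han⟩), card_pair hbn]
    exact hc ▸ card_le_card hsub
  have h2 : 2 ≤ X''.card := by omega
  -- `□_n` is far: a site of `□_n` coupled to `□_a` would lie in `□_b`
  have hfar : ∀ x y, blk x = n → blk y = a → Δ x y = 0 := fun x y hx hy => by
    by_contra h
    exact hbn ((hnbr x y (hx ▸ hnX) (fun h' => han (h'.symm.trans hx)) hy h).symm.trans hx)
  -- every slot located in the polymer sits at `□_a`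
  have hslot : ∀ τ : ↥(slotB B Ys cube X) ⊕ ↥(slotY B Ys cube X), cubeIn cube X τ ∈ X'' → cubeIn cube X τ = a := by
    intro τ hτ
    rcases τ with b' | Y
    · exact hfree _ hτ
    · exact hfree _ hτ
  have hHa : ∀ j ∈ H, cubeIn cube X (γ j) = a := fun j hj => hslot _ (hloc j hj)
  have hfreei : ∀ i ∈ X'', i ≠ a → ∀ τ : ↥B ⊕ ↥Ys, cube τ ≠ i := fun i hi hia τ hτ =>
    hia ((hfree τ (hτ ▸ hi)).symm.trans hτ).symm
  -- the observable of the polymer is the decorated cube's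
  have hprod : ∀ ψ : α → ℝ, ∏ i ∈ X'',
      fD (uD χ p ek (slotB B Ys cube X) (fun b : ↥B => Φ b) (fun b : ↥B => c b) (slotY B Ys cube X) (fun Y : ↥Ys => V Y) t)
        (cubeIn cube X) γ H i ψ =
      fD (uD χ p ek (slotB B Ys cube X) (fun b : ↥B => Φ b) (fun b : ↥B => c b) (slotY B Ys cube X) (fun Y : ↥Ys => V Y) t)
        (cubeIn cube X) γ H a ψ := fun ψ =>
    prod_eq_single_of_mem a haX fun i hi hia => fD_eq_one_of_free χ p ek B Φ c Ys V cube X t γ (hfreei i hi hia) H ψ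
  -- the engine's hypotheses
  have hcs := corner_mem_cube (I := I) Λc
  have hΔc : (interpForm blk Δ (corner ℝ Λc)).PosDef := interpForm_posDef blk hΔ hcs
  have hmΔc : ∀ φ : α → ℝ, m * (φ ⬝ᵥ φ) ≤ φ ⬝ᵥ (interpForm blk Δ (corner ℝ Λc) *ᵥ φ) := quadForm_interpForm_ge blk hΔm hcs
  obtain ⟨Cu, hCu⟩ := exists_quadForm_le (interpForm blk Δ (corner ℝ Λc))
  have hf : ∀ i (φ ψ : α → ℝ), (∀ x, blk x = i → φ x = ψ x) →
      fD (uD χ p ek (slotB B Ys cube X) (fun b : ↥B => Φ b) (fun b : ↥B => c b) (slotY B Ys cube X) (fun Y : ↥Ys => V Y) t)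
        (cubeIn cube X) γ H i φ =
      fD (uD χ p ek (slotB B Ys cube X) (fun b : ↥B => Φ b) (fun b : ↥B => c b) (slotY B Ys cube X) (fun Y : ↥Ys => V Y) t)
        (cubeIn cube X) γ H i ψ := fun i φ ψ h =>
    fD_local blk γ (uD_local blk χ (cubeIn cube X) (fun b' φ ψ h => hΦloc b'.1 φ ψ h) (fun Y φ ψ h => hVloc Y.1 φ ψ h) t) H i φ ψ h
  have hfm : Measurable fun ψ : α → ℝ => ∏ i ∈ X'',
      fD (uD χ p ek (slotB B Ys cube X) (fun b : ↥B => Φ b) (fun b : ↥B => c b) (slotY B Ys cube X) (fun Y : ↥Ys => V Y) t)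
        (cubeIn cube X) γ H i ψ := by
    rw [show (fun ψ : α → ℝ => ∏ i ∈ X'',
        fD (uD χ p ek (slotB B Ys cube X) (fun b : ↥B => Φ b) (fun b : ↥B => c b) (slotY B Ys cube X) (fun Y : ↥Ys => V Y) t)
          (cubeIn cube X) γ H i ψ) = fun ψ =>
        fD (uD χ p ek (slotB B Ys cube X) (fun b : ↥B => Φ b) (fun b : ↥B => c b) (slotY B Ys cube X) (fun Y : ↥Ys => V Y) t)
          (cubeIn cube X) γ H a ψ from funext hprod]
    exact measurable_fD_of_inr χ p ek B Φ c Ys V cube X t γ haV hV H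
  have hlocP : ∀ φ ψ : α → ℝ, (∀ x, ¬ (fun x => blk x ≠ a) x → φ x = ψ x) →
      (∏ i ∈ X'',
        fD (uD χ p ek (slotB B Ys cube X) (fun b : ↥B => Φ b) (fun b : ↥B => c b) (slotY B Ys cube X) (fun Y : ↥Ys => V Y) t)
          (cubeIn cube X) γ H i φ) =
      ∏ i ∈ X'',
        fD (uD χ p ek (slotB B Ys cube X) (fun b : ↥B => Φ b) (fun b : ↥B => c b) (slotY B Ys cube X) (fun Y : ↥Ys => V Y) t)
          (cubeIn cube X) γ H i ψ := fun φ ψ h => by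
    rw [hprod, hprod]
    exact hf a φ ψ fun x hx => h x (not_ne_iff.2 hx)
  have hPn : ∀ x, blk x = n → (fun x => blk x ≠ a) x := fun x hx h => han (h.symm.trans hx)
  have hfar' : ∀ x y, blk x = n → ¬ (fun x => blk x ≠ a) y → Δ x y = 0 := fun x y hx hy => hfar x y hx (not_ne_iff.1 hy)
  have hM0 : 0 ≤ W * R * ((W * (c₁ * δ ^ (X''.card - 2) * R)) ^ 2 * m⁻¹) :=
    mul_nonneg (mul_nonneg (Nat.cast_nonneg _) hR0) (mul_nonneg (sq_nonneg _) (inv_nonneg.2 hm.le))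
  -- the size-free clauses give the `N`-cube regime inequality paying all `N − 1` undecorated cubes
  have hreg : 2 ^ (X''.card - 1) * (W * R * ((W * (c₁ * δ ^ (X''.card - 2) * R)) ^ 2 * m⁻¹)) ≤ θ ^ (β' * ((X''.card : ℝ) - 1)) := by
    obtain ⟨k, hk⟩ : ∃ k, X''.card = k + 3 := ⟨X''.card - 3, by omega⟩
    rw [hk, show k + 3 - 1 = k + 2 by omega, show k + 3 - 2 = k + 1 by omega, Nat.cast_add, Nat.cast_ofNat,
      show β' * ((k : ℝ) + 3 - 1) = β' * ((k : ℝ) + 2) by ring]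
    exact regime_chainN_all (Nat.cast_nonneg W) hR0 hm hθ0 hδθ₂ hstep k
  have hexpG : Real.exp (G * K₁) ≤ Real.exp (2 * G * K₁) :=
    Real.exp_le_exp.2 (by nlinarith [mul_nonneg (Nat.cast_nonneg G) hK₁0])
  rcases H.eq_empty_or_nonempty with rfl | hHne
  · -- the vacuum chain: `c₀ = 1`, `K₀ = θ^{β′}/2` (ONE cube's worth: `□_a`'s)
    have hK0 : ∀ ψ : α → ℝ, |(∏ i ∈ X'',
        fD (uD χ p ek (slotB B Ys cube X) (fun b : ↥B => Φ b) (fun b : ↥B => c b) (slotY B Ys cube X) (fun Y : ↥Ys => V Y) t)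
          (cubeIn cube X) γ ∅ i ψ) - 1| ≤ θ ^ β' / 2 := fun ψ => by
      rw [hprod]
      refine (abs_fD_empty_sub_one_le χ p ek B Φ c Ys V cube X t γ haV hK hK₁0 hK₁ hG ht0 ht1 ψ).trans ?_
      linarith
    have hb := abs_actIn_le_of_condMean_fluct blk Δ 0 adj χ p ek B Φ c Ys V cube Λc X t γ ∅ h2 hΔc hm hmΔc hCu hf hfm 1 hK0
      (fun x => blk x ≠ a) hlocP hnX hPn hfar'
      (fun s hs hs0 => fluct_le_chainN blk hΔ hm hΔm hab han X'' hfar hnbr hW hR0 hR ds hc₁ hδ0 hδ1 (X''.card - 2) hgeo Λc hs hs0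
        (hdec s hs hs0))
    refine hb.trans ?_
    rw [card_empty, image_empty, sdiff_empty]
    push_cast
    exact bookkeeping_empty_all hθ0 hreg
  · -- the decorated chains: `c₀ = 0`, `K₀ = (θ/2)^{|H|}` (print's per-derivative factor, no located surplus)
    have hk : 1 ≤ H.card := by have := card_pos.2 hHne; omega
    have hκ : ∀ Y ∈ Ys, KY Y ≤ θ / 2 / Real.exp (2 * G * K₁) := fun Y hY =>
      (le_div_iff₀ (Real.exp_pos _)).2 (hKθ Y hY)
    have hθp : 0 ≤ θ / 2 := div_nonneg hθ0.le (by norm_num)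
    have hκ0 : 0 ≤ θ / 2 / Real.exp (2 * G * K₁) := div_nonneg hθp (Real.exp_pos _).le
    have hE1 : 1 ≤ Real.exp (2 * G * K₁) :=
      Real.one_le_exp (mul_nonneg (mul_nonneg (by norm_num) (Nat.cast_nonneg _)) hK₁0)
    have hK0 : ∀ ψ : α → ℝ, |(∏ i ∈ X'',
        fD (uD χ p ek (slotB B Ys cube X) (fun b : ↥B => Φ b) (fun b : ↥B => c b) (slotY B Ys cube X) (fun Y : ↥Ys => V Y) t)
          (cubeIn cube X) γ H i ψ) - 0| ≤ (θ / 2) ^ H.card := fun ψ => by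
      rw [sub_zero, hprod]
      refine (abs_fD_le_of_inr χ p ek B Φ c Ys V cube X t γ haV hK hK₁0 hK₁ hG ht0 ht1 hκ0 hκ H hHa ψ).trans ?_
      rw [div_pow, div_mul_eq_mul_div, div_le_iff₀ (pow_pos (Real.exp_pos _) _)]
      exact mul_le_mul_of_nonneg_left (hexpG.trans (le_self_pow₀ hE1 (by omega))) (pow_nonneg hθp _)
    have hb := abs_actIn_le_of_condMean_fluct blk Δ 0 adj χ p ek B Φ c Ys V cube Λc X t γ H h2 hΔc hm hmΔc hCu hf hfm 0 hK0
      (fun x => blk x ≠ a) hlocP hnX hPn hfar'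
      (fun s hs hs0 => fluct_le_chainN blk hΔ hm hΔm hab han X'' hfar hnbr hW hR0 hR ds hc₁ hδ0 hδ1 (X''.card - 2) hgeo Λc hs hs0
        (hdec s hs hs0))
    refine hb.trans ?_
    -- `a ∈ □(γ(H))`, so at most `|X″| − 1` undecorated cubes
    have hcard : ((X'' \ H.image (cubeIn cube X ∘ γ)).card : ℝ) ≤ (X''.card : ℝ) - 1 := by
      obtain ⟨j, hj⟩ := hHne
      have ha : a ∈ H.image (cubeIn cube X ∘ γ) := mem_image.2 ⟨j, hj, hHa j hj⟩
      have hsub : X'' \ H.image (cubeIn cube X ∘ γ) ⊆ X''.erase a := by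
        intro i hi
        rw [Finset.mem_sdiff] at hi
        exact mem_erase.2 ⟨fun h => hi.2 (h ▸ ha), hi.1⟩
      have hc : (X'' \ H.image (cubeIn cube X ∘ γ)).card + 1 ≤ X''.card := by
        calc (X'' \ H.image (cubeIn cube X ∘ γ)).card + 1 ≤ (X''.erase a).card + 1 := Nat.add_le_add_right (card_le_card hsub) 1
          _ = X''.card := card_erase_add_one haX
      have hc' : ((X'' \ H.image (cubeIn cube X ∘ γ)).card : ℝ) + 1 ≤ (X''.card : ℝ) := by exact_mod_cast hc
      linarith
    calc _ ≤ θ ^ ((H.card : ℝ) + β' * ((X''.card : ℝ) - 1)) := bookkeeping_nonempty_all hθ0 hk hM0 hreg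
      _ ≤ _ := Real.rpow_le_rpow_of_exponent_ge hθ0 hθ1 (by nlinarith [hcard, hβ])

/-- **the same with the decay derived from `Δ`-letters** (range `1` in a site pseudo-distance `d`, `|Δ_{xy}| ≤ h`, `≤ z` neighbours, rate `μ`
with `h z(e^μ − 1) ≤ m/2`, unit `ℓ > 0`, face clause `(|X″| − 2)·ℓ ≤ d(x,l)`; `c₁ = 2/m`, `δ = e^{−μℓ}`).
[cite: BalabanImbrieJaffe1988, (5.14.4) p.309–310; §5.13 p.305, p.307] [cite: CombesThomas1973, §II] -/
theorem ineq5144_locAct_endChainN_of_combesThomas_walkCount [Fintype ι] [Fintype υ]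
    (hΔ : Δ.PosDef) {m : ℝ} (hm : 0 < m) (hΔm : ∀ φ : α → ℝ, m * (φ ⬝ᵥ φ) ≤ φ ⬝ᵥ (Δ *ᵥ φ))
    (hΦloc : ∀ b : B, ∀ φ ψ : α → ℝ, (∀ x, blk x = cube (Sum.inl b) → φ x = ψ x) → Φ b φ = Φ b ψ)
    (hVloc : ∀ Y : Ys, ∀ φ ψ : α → ℝ, (∀ x, blk x = cube (Sum.inr Y) → φ x = ψ x) → V Y φ = V Y ψ)
    (hV : ∀ Y ∈ Ys, Measurable (V Y)) {KY : υ → ℝ} (hK : ∀ Y ∈ Ys, ∀ φ, |V Y φ| ≤ KY Y)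
    {K₁ : ℝ} (hK₁0 : 0 ≤ K₁) (hK₁ : ∀ Y ∈ Ys, KY Y ≤ K₁) {G : ℕ} (hG : ∀ i, (univ.filter fun τ : ↥B ⊕ ↥Ys => cube τ = i).card ≤ G)
    {θ β' : ℝ} (hθ0 : 0 < θ) (hθ1 : θ ≤ 1) (hβ : 0 ≤ β')
    (hvac₁ : Real.exp (2 * G * K₁) - 1 ≤ θ ^ β' / 2) (hKθ : ∀ Y ∈ Ys, KY Y * Real.exp (2 * G * K₁) ≤ θ / 2)
    {W : ℕ} (hW : ∀ i, (univ.filter fun x : α => blk x = i).card ≤ W)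
    {R : ℝ} (hR0 : 0 ≤ R) (hR : ∀ x, ∑ y ∈ univ.filter (fun y => blk y ≠ blk x), |Δ x y| ≤ R)
    (hℱ : ℱ = 0) (X'' : Finset I) {a b n : I} (haX : a ∈ X'') (hbX : b ∈ X'') (hnX : n ∈ X'') (hab : a ≠ b) (han : a ≠ n) (hbn : b ≠ n)
    (haV : ∀ b' : ↥B, cube (Sum.inl b') ≠ a) (hfree : ∀ τ : ↥B ⊕ ↥Ys, cube τ ∈ X'' → cube τ = a)
    (hnbr : ∀ l k, blk l ∈ X'' → blk l ≠ a → blk k = a → Δ l k ≠ 0 → blk l = b)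
    -- the `Δ`-letters replacing the decay letter: range, coupling size, neighbour count, Combes–Thomas rate, unit, face clause
    (d : α → α → ℝ) (hd0 : ∀ i, d i i = 0) (hdsymm : ∀ i k, d i k = d k i) (hdtri : ∀ i j k, d i k ≤ d i j + d j k)
    (hband : ∀ x y, 1 < d x y → Δ x y = 0) {h : ℝ} (hh0 : 0 ≤ h) (hh : ∀ x y, x ≠ y → |Δ x y| ≤ h)
    {z : ℝ} (hz : ∀ x, ((univ.filter fun y => y ≠ x ∧ d x y ≤ 1).card : ℝ) ≤ z)
    {μ : ℝ} (hμ : 0 ≤ μ) (hsmall : h * z * (Real.exp μ - 1) ≤ m / 2) {ℓ : ℝ} (hℓ : 0 < ℓ)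
    (hface : ∀ x l, (blk x = n ∨ (blk x ∈ X'' ∧ ∃ y, blk y = n ∧ Δ y x ≠ 0)) → blk l = b → (∃ k, blk k = a ∧ Δ l k ≠ 0) →
      ((X''.card : ℝ) - 2) * ℓ ≤ d x l)
    (Λc X : Finset I)
    (hδθ₂ : 4 * ((W : ℝ) ^ 3 * R ^ 3 * (2 / m) ^ 2 * Real.exp (-(μ * ℓ)) ^ 2) ≤ m * θ ^ (2 * β'))
    (hstep : 2 * Real.exp (-(μ * ℓ)) ^ 2 ≤ θ ^ β')
    {t : ℝ} (ht0 : 0 ≤ t) (ht1 : t ≤ 1) {L : Type} [DecidableEq L] (γ : L → ↥(slotB B Ys cube X) ⊕ ↥(slotY B Ys cube X)) (H : Finset L) :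
    |locAct (cubeIn cube X ∘ γ) (actIn blk Δ ℱ adj χ p ek B Φ c Ys V cube Λc X t γ) H X''| ≤
      θ ^ ((H.card : ℝ) + β' * ((X'' \ H.image (cubeIn cube X ∘ γ)).card : ℝ)) := by
  have hdnn : ∀ x y, 0 ≤ d x y := fun x y => by
    have h1 := hdtri x y x
    rw [hd0, hdsymm y x] at h1
    linarith
  have h2 : 2 ≤ X''.card := Finset.one_lt_card.2 ⟨a, haX, n, hnX, han⟩
  have hcast : (((X''.card - 2 : ℕ) : ℝ)) = (X''.card : ℝ) - 2 := by
    rw [Nat.cast_sub h2, Nat.cast_ofNat]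
  exact ineq5144_locAct_endChainN_of_decay_walkCount blk Δ ℱ adj χ p ek B Φ c Ys V cube hΔ hm hΔm hΦloc hVloc hV hK hK₁0 hK₁ hG hθ0 hθ1
    hβ hvac₁ hKθ hW hR0 hR hℱ X'' haX hbX hnX hab han hbn haV hfree hnbr (fun x l => ⌊d x l / ℓ⌋₊) (div_nonneg (by norm_num) hm.le)
    (Real.exp_pos _).le (Real.exp_le_one_iff.2 (neg_nonpos.2 (mul_nonneg hμ hℓ.le)))
    (fun x l hx hl hk => (Nat.le_floor_iff (div_nonneg (hdnn x l) hℓ.le)).2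
      (by rw [hcast, le_div_iff₀ hℓ]; exact hface x l hx hl hk))
    Λc X (fun s hs _ x l => restricted_inv_decay_pow blk d hd0 hdsymm hdtri hband hh0 hh hz hΔ hm hΔm hμ hsmall hℓ Λc hs _ x l)
    hδθ₂ hstep ht0 ht1 γ H

end Main

end Literature.MathematicalPhysics.QuantumFieldTheory.BalabanImbrieJaffe1984to88.BIJ88Ineq5144EndChainNWalkCount

end
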